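import Literature.Analysis.FluidPDE.SourcedScalarBudget

/-!
# Stub A `stub_condensateAveragedIdentity` of the condensate theorem (crux `TwohalfdNeg`,
line `log-kantorovich-enstrophy-transfer`)

The averaged tested identity of a global weak sourced passive scalar
(`Torus.IsWeakScalarTransportForced κ u (fun _ => h) θ₀ θ`) against a smooth steady test field
`φ`: the a.e.-in-time identity of `PassiveScalarSteadyTest`
(`Torus.IsWeakScalarTransportForcedOn.ae_integral_mul_eq`),

  `∫ θ(t) φ = ∫ θ₀ φ + ∫_{(0,t]} (∫ θ(τ) (⟪u(τ), ∇φ⟫ + κΔφ) + ∫ h φ) dτ` for a.e. `t ∈ (0,T)`,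

integrated over `t ∈ (0,T)`:

  `∫₀ᵀ ∫₀ᵗ ∫ θ(τ) (⟪u(τ), ∇φ⟫ + κΔφ) dτ dt + (T²/2) ∫ h φ = ∫₀ᵀ (∫ θ(t) φ − ∫ θ₀ φ) dt`.

The only analysis is bookkeeping: the source term is `∫_{(0,t]} ∫ h φ = t ∫ h φ` and
`∫₀ᵀ t dt = T²/2`; the primitive `t ↦ ∫₀ᵗ F` of the integrable flux `F` is continuous, hence
interval integrable, so the interval integral of the sum splits.
-/

namespace Summit.AnomalousDissipation.AnomalousDissipation.Theorems.TwohalfdNeg.Condensate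

open MeasureTheory Filter Topology
open scoped ENNReal NNReal InnerProductSpace
open Literature.Analysis.FunctionSpaces Literature.Analysis.FluidPDE

set_option linter.dupNamespace false

/-- **Averaging an a.e. primitive identity over `(0,T)`** (pure real analysis). If `F` is
integrable on `(0,T)` and `U t = U₀ + ∫_{(0,t]} (F + c)` for a.e. `t ∈ (0,T)`, then
`∫₀ᵀ ∫₀ᵗ F + (T²/2) c = ∫₀ᵀ (U − U₀)`. [folklore] -/
theorem intervalIntegral_primitive_add_sq_half_mul_eq_of_ae {F U : ℝ → ℝ} {U₀ c T : ℝ}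
    (hT : 0 < T) (hFi : IntegrableOn F (Set.Ioo 0 T) volume)
    (hae : ∀ᵐ t ∂(volume.restrict (Set.Ioo 0 T)), U t = U₀ + ∫ τ in Set.Ioc 0 t, (F τ + c)) :
    (∫ t in (0 : ℝ)..T, ∫ τ in (0 : ℝ)..t, F τ) + T ^ 2 / 2 * c =
      ∫ t in (0 : ℝ)..T, (U t - U₀) := by
  have hFi' : IntegrableOn F (Set.Icc 0 T) volume := hFi.congr_set_ae Ioo_ae_eq_Icc.symm
  -- the a.e. identity with the source term evaluated and the primitive in interval form
  have hae' : ∀ᵐ t ∂(volume.restrict (Set.Ioo 0 T)),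
      U t - U₀ = (∫ τ in (0 : ℝ)..t, F τ) + t * c := by
    filter_upwards [hae, ae_restrict_mem measurableSet_Ioo] with t ht htm
    have hFt : IntegrableOn F (Set.Ioc 0 t) volume :=
      hFi'.mono_set (Set.Ioc_subset_Icc_self.trans (Set.Icc_subset_Icc_right htm.2.le))
    rw [ht, integral_add hFt (integrableOn_const (measure_Ioc_lt_top (μ := volume)).ne),
      setIntegral_const, Real.volume_real_Ioc_of_le htm.1.le, intervalIntegral.integral_of_le htm.1.le,
      smul_eq_mul, sub_zero]
    ring
  -- the primitive of `F` is continuous on `[0,T]`, hence interval integrable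
  have hprim : IntervalIntegrable (fun t => ∫ τ in (0 : ℝ)..t, F τ) volume 0 T := by
    refine ContinuousOn.intervalIntegrable ?_
    have hu : IntegrableOn F (Set.uIcc 0 T) volume := by rwa [Set.uIcc_of_le hT.le]
    exact intervalIntegral.continuousOn_primitive_interval hu
  have hlin : IntervalIntegrable (fun t => t * c) volume 0 T :=
    (continuous_id.mul continuous_const).intervalIntegrable _ _
  have eR : ∫ t in (0 : ℝ)..T, (U t - U₀) =
      ∫ t in (0 : ℝ)..T, ((∫ τ in (0 : ℝ)..t, F τ) + t * c) := by
    rw [intervalIntegral.integral_of_le hT.le, intervalIntegral.integral_of_le hT.le,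
      integral_Ioc_eq_integral_Ioo, integral_Ioc_eq_integral_Ioo]
    exact integral_congr_ae hae'
  rw [eR, intervalIntegral.integral_add hprim hlin, intervalIntegral.integral_mul_const, integral_id]
  ring

/-- **Stub A — the averaged tested identity.** For a global weak sourced scalar and a smooth
steady test field `φ`, the a.e.-in-time identity of `PassiveScalarSteadyTest` integrated over
`t ∈ (0,T)`: `∫₀ᵀ∫₀ᵗ ∫θ(τ)(⟪u,∇φ⟫ + κΔφ) dτ dt + (T²/2)∫hφ = ∫₀ᵀ (∫θ(t)φ − ∫θ₀φ) dt`. [folklore] -/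
theorem stub_condensateAveragedIdentity :
    ∀ (κ T : ℝ) (u : ℝ → UnitAddTorus (Fin 2) → EuclideanSpace ℝ (Fin 2))
      (h θ₀ : UnitAddTorus (Fin 2) → ℝ) (θ : ℝ → UnitAddTorus (Fin 2) → ℝ)
      (φ : UnitAddTorus (Fin 2) → ℝ),
      0 < T → Torus.IsWeakScalarTransportForced κ u (fun _ => h) θ₀ θ → Torus.IsSmooth φ →
      (∫ t in (0 : ℝ)..T, ∫ τ in (0 : ℝ)..t, ∫ x, θ τ x *
          (inner ℝ (u τ x) (Torus.gradient φ x) + κ * Torus.laplacian φ x)) +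
        T ^ 2 / 2 * ∫ x, h x * φ x =
      ∫ t in (0 : ℝ)..T, ((∫ x, θ t x * φ x) - ∫ x, θ₀ x * φ x) := by
  intro κ T u h θ₀ θ φ hT hθ hφ
  have hFi : IntegrableOn (fun τ => ∫ x, θ τ x *
      (⟪u τ x, Torus.gradient φ x⟫_ℝ + κ * Torus.laplacian φ x)) (Set.Ioo 0 T) volume :=
    ((hθ T hT).integrable_mul_steadyFlux hφ).integral_prod_left
  have hae : ∀ᵐ t ∂(volume.restrict (Set.Ioo 0 T)),
      ∫ x, θ t x * φ x = (∫ x, θ₀ x * φ x) + ∫ τ in Set.Ioc 0 t, ((∫ x, θ τ x *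
        (⟪u τ x, Torus.gradient φ x⟫_ℝ + κ * Torus.laplacian φ x)) + ∫ x, h x * φ x) := by
    filter_upwards [(hθ T hT).ae_integral_mul_eq hφ] with t ht
    simpa only using ht
  exact intervalIntegral_primitive_add_sq_half_mul_eq_of_ae hT hFi hae

end Summit.AnomalousDissipation.AnomalousDissipation.Theorems.TwohalfdNeg.Condensate
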